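import Summits.HodgeConjecture.HodgeConjecture.Theorems.SixfoldTableXCensusSimpleRows
import Literature.AlgebraicGeometry.HodgeTheory.RibetTypeOnePowersHodgeClasses
import HarnessLib

/-!
# TABLE X (dimension 6) — row 8 `g6.IV(1,1)`, the `(5,1)` HALF: the census nodes X2 / X1 DISCHARGED IN THE KERNEL on
# the whole isogeny class of every sixfold of Ribet type `(dim − 1, 1)` (Ribet 1983 Thm. 3 — a PROVED tree theorem,
# `AbelianVariety.isDivisorGenerated_of_ribetTypeOne`), unconditionally (cell `pub-hodgeav-hg6`, req-37 (A) Q2b; eng-2 g4)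

HONEST FRAMING. HC, `HC_AV` (stmt-1333), `HC_CM` (stmt-3052) and the rung H2 are NOT proved and do not occur here. The
census nodes `TableX.SixfoldCodimTwoCensus` (X2) / `TableX.SixfoldCodimThreeCensus` (X1) of `SixfoldTableXCover` are OURS
(`@[conjecture]`), never asserted. KERNEL ONLY: theorems over existing declarations; no definition, no `sorry`, no named
fact (every input is a THEOREM of the tree); typed ≠ proved.

WHY THIS MODULE (census-node self-audit, axis A7 «a row VERIFIED in the kernel, not by dossier», continued). L8 / L9 /
L10 (`SixfoldTableXCensusEllipticRows`, `…ProductRows`, `…SimpleRows`) verified the per-variety conclusions of X2 / X1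
on every TABLE X row on which `B = D` (`IsDivisorGenerated`) is an unconditional tree theorem, and recorded rows
8 / 10 / 12 (type IV, non-Weil signatures) as «no tree `B = D` theorem; Ribet's coprime-signature theorem is a named fact
only». For the `(5,1)` HALF of row 8 (`HOME/TABLE-X-g6-v0.md` §1 row 8 `g6.IV(1,1).(5,1)∣(4,2)`: `End⁰(B)` an imaginary
quadratic field `k = ℚ(√-d)` acting on `T₀B` with multiplicities `(5,1)`) that is NO LONGER SO: the Literature lane's
programme R9 landed Ribet 1983 Thm. 3 in the case `(dim B − 1, 1)`, `dim B ≥ 3`, as the UNCONDITIONAL theorem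
`AbelianVariety.isDivisorGenerated_of_ribetTypeOne` (file `HodgeTheory/RibetTypeOnePowersHodgeClasses`, whose docstring
names «`(5,1)` sixfolds» explicitly; Lie step `UnitaryTheta.mem_hodgeLie_iff_commute_and_skew` = `Lie Hg = 𝔲_k(V, ψ)`,
`HodgeThetaSubalgebraUnitary`; assembly `UnitaryTypeSlotsHodgeClasses`). THIS FILE feeds that theorem into L10's entry
point `SimpleRows.census_of_isIsogenous_of_isDivisorGenerated`:
* §1 `isField_of_finrank_eq_two_of_mul_self_eq_neg` — a `ℚ`-algebra of dimension `2` containing a square root of a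
  negative rational is a field (elementary); `isField_endAlgebra_of_ribetTypeOne` — hence `End⁰(B)` is a field for
  `φ ≫ φ = -d`, `d > 0`, `dim_ℚ End⁰(B) = 2`, so `B` is SIMPLE (`AbelianVariety.isSimple_of_isField_endAlgebra`) and NOT of
  CM type (`SimpleRows.not_isOfCMType_of_finrank_endAlgebra_lt_two_mul_dim`, `2 < 2 dim B`).
* §2 `census_of_isIsogenous_ribetTypeOne` — for `B` of Ribet type `(dim B − 1, 1)`, `dim B ≥ 3` (the tree's hypotheses
  VERBATIM: `φ ≫ φ = -(d • 𝟙 B)`, `0 < d`, `finrank_ℚ End⁰(B) = 2`, `eigenMultiplicity B φ (±i√d) = 1`), both census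
  conclusions X2-at-`A`, X1-at-`A` hold at every `A ∼ B` (any dimension); `hodgeConjectureFor_of_isIsogenous_ribetTypeOne`
  — L6's CONCLUSION `HodgeConjectureFor` on the whole isogeny class, from the tree's `B = D` by
  `hodgeConjectureFor_of_isIsogenous_of_isDivisorGenerated` (on `B` and its powers it is the tree's
  `hodgeConjectureFor_powSucc_of_ribetTypeOne` BY NAME — nothing restated).
* §3 `census_row8_fiveOne` — TABLE X row 8, `(5,1)` half, KERNEL VERDICT: `dim B = 6` and every `A ∼ B` is IN THE NODES'
  DOMAIN `dim A = 6 ∧ ¬ 𝒞 A` (`𝒞` = CM ∪ K3-partner cell, spelled as in L6 / L7) AND satisfies X2-at-`A` ∧ X1-at-`A`;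
  `offResidueSix_of_isIsogenous_ribetTypeOne` (membership alone).

WHAT IS NOT COVERED (honest scope): the `(4,2)` half of row 8 (`k` acting with multiplicities `(4,2)`: `gcd = 2`, outside
Ribet's coprime theorem; `Hg = U_k(V,ψ)` there is Tankeev 1996 / the atlas' §23 — no tree theorem; TABLE X row 31 records
«`(4,2)` `k`-sixfold with smaller `Hg`: VACUOUS in dim 6» as a CELL INFERENCE only), rows 10 / 12 (quartic / sextic CM
centre: the tree's unconditional `B = D` of this shape is `isDivisorGenerated_of_quarticCM`, for FOURFOLDS only), row 1,
row 5, the Weil rows 7 / 9 / 11 / 13 and the CM rows 14 / 15 — exactly as L10 lists them. No conditional census claim is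
made. No inhabitant is exhibited: the tree holds no existence record of a sixfold with `End⁰ = ℚ(√-d)` of signature
`(5,1)` (its `(5,1)` records, e.g. `Ring2MotivConiveauThreeOne.exists_cmCurve_eigenMultiplicity_eq`, are CM curves), and
none is invented here.

All declarations live in the sub-namespace `TableX.TypeIVRows` (lead g2 DEDUP RULE 2026-08-28T20:17:40Z: import L10's
entry points, restate nothing; import-independent of L9). Nothing here is a corollary of `HC_CM`; no hypothesis of the
cover is discharged GLOBALLY (X2 / X1 quantify over ALL off-residue sixfolds and stay `@[conjecture]`); typed ≠ proved.
-/

set_option linter.dupNamespace false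

noncomputable section

open CategoryTheory
open Literature.AlgebraicGeometry Literature.AlgebraicGeometry.Motives
open Literature.AlgebraicGeometry.Motives.AbelianVariety (IsIsogenous IsSimple isSimple_of_isField_endAlgebra)
open Literature.AlgebraicGeometry.HodgeTheory
open Literature.AlgebraicGeometry.Milne1999
open Literature.AlgebraicTopology.SingularHomology
open Literature.Barriers.HodgeConjecture
open Summit.HodgeConjecture.HodgeConjecture.Ring2.ClassTargets
open Summit.HodgeConjecture.HodgeConjecture.Ring2.Motiv (ProdCMCell)
open Summit.HodgeConjecture.HodgeConjecture.Ring2.Atlas (IsQuarticFieldTypeIVFourfold)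
open Summit.HodgeConjecture.HodgeConjecture.TableX.SimpleRows

namespace Summit.HodgeConjecture.HodgeConjecture.TableX.TypeIVRows

/-! ## §1 `End⁰(B) = ℚ(√-d)` is a field: `B` is simple and not of CM type -/

/-- **A `ℚ`-algebra of dimension `2` containing `x` with `x² = -d`, `d > 0`, is a field** (it is `ℚ ⊕ ℚx ≅ ℚ(√-d)`:
`1, x` are independent since `-d` is not a rational square, hence a basis; `(a + bx)(a - bx) = a² + d b² ≠ 0` for
`(a, b) ≠ 0`). Elementary. [cite: MumfordAV1970, §19 Cor. 2 of Thm. 1 (p. 174) and §21 (type IV)] -/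
theorem isField_of_finrank_eq_two_of_mul_self_eq_neg {R : Type*} [Ring R] [Algebra ℚ R]
    (h2 : Module.finrank ℚ R = 2) {x : R} {d : ℚ} (hd : 0 < d) (hx : x * x = -(d • (1 : R))) : IsField R := by
  classical
  haveI : Nontrivial R := Module.nontrivial_of_finrank_pos (R := ℚ) (by omega)
  haveI : Module.Finite ℚ R := Module.finite_of_finrank_eq_succ h2
  -- `1, x` are linearly independent
  have hli : LinearIndependent ℚ ![(1 : R), x] := by
    refine LinearIndependent.pair_iff.2 fun s t hst => ?_
    by_cases ht : t = 0
    · rw [ht, zero_smul, add_zero, smul_eq_zero] at hst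
      exact ⟨hst.resolve_right one_ne_zero, ht⟩
    · exfalso
      -- `x = q • 1` with `q = -s/t`, so `x² = q² ≥ 0` contradicts `x² = -d`
      have hxq : x = (-(s / t)) • (1 : R) := by
        have h1 : t • x = -(s • (1 : R)) := eq_neg_of_add_eq_zero_right hst
        have h2 : x = t⁻¹ • (t • x) := by rw [smul_smul, inv_mul_cancel₀ ht, one_smul]
        rw [h2, h1, smul_neg, smul_smul, neg_smul, div_eq_inv_mul]
      have hsq : x * x = ((s / t) * (s / t)) • (1 : R) := by
        rw [hxq, smul_mul_smul_comm, mul_one, neg_mul_neg]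
      have h0 : ((s / t) * (s / t) + d) • (1 : R) = 0 := by
        rw [add_smul, ← hsq, hx, neg_add_cancel]
      rw [smul_eq_zero] at h0
      rcases h0 with h0 | h0
      · nlinarith [mul_self_nonneg (s / t)]
      · exact one_ne_zero h0
  -- hence a basis `b = (1, x)` of `R`
  let b : Module.Basis (Fin 2) ℚ R := basisOfLinearIndependentOfCardEqFinrank hli (by rw [h2, Fintype.card_fin])
  have hb0 : b 0 = 1 := by
    rw [coe_basisOfLinearIndependentOfCardEqFinrank]; rfl
  have hb1 : b 1 = x := by
    rw [coe_basisOfLinearIndependentOfCardEqFinrank]; rfl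
  have hrepr : ∀ r : R, r = (b.repr r 0) • (1 : R) + (b.repr r 1) • x := fun r => by
    conv_lhs => rw [← b.sum_repr r]
    rw [Fin.sum_univ_two, hb0, hb1]
  -- the multiplication table
  have hmul : ∀ a c a' c' : ℚ, (a • (1 : R) + c • x) * (a' • (1 : R) + c' • x) =
      (a * a' - c * c' * d) • (1 : R) + (a * c' + c * a') • x := by
    intro a c a' c'
    rw [add_mul, mul_add, mul_add, smul_mul_smul_comm, smul_mul_smul_comm, smul_mul_smul_comm, smul_mul_smul_comm,
      mul_one, mul_one, one_mul, hx, smul_neg, ← neg_smul, smul_smul, sub_eq_add_neg, add_smul, add_smul, neg_mul,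
      neg_smul]
    abel
  refine { exists_pair_ne := ⟨0, 1, zero_ne_one⟩, mul_comm := fun r s => ?_, mul_inv_cancel := fun {r} hr => ?_ }
  · rw [hrepr r, hrepr s, hmul, hmul]
    congr 1
    · rw [mul_comm (b.repr r 0), mul_comm (b.repr r 1)]
    · rw [mul_comm (b.repr r 0), mul_comm (b.repr r 1), add_comm]
  · set a := b.repr r 0 with ha
    set c := b.repr r 1 with hc
    have hN : a * a + d * (c * c) ≠ 0 := by
      intro hN
      have ha0 : a = 0 := by nlinarith [mul_self_nonneg a, mul_self_nonneg c]
      have hc0 : c * c = 0 := by nlinarith [mul_self_nonneg a, mul_self_nonneg c]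
      have hc0' : c = 0 := mul_self_eq_zero.1 hc0
      exact hr (by rw [hrepr r, ← ha, ← hc, ha0, hc0', zero_smul, zero_smul, add_zero])
    refine ⟨((a * a + d * (c * c))⁻¹ * a) • (1 : R) + (-((a * a + d * (c * c))⁻¹ * c)) • x, ?_⟩
    rw [hrepr r, ← ha, ← hc, hmul]
    have h1 : a * ((a * a + d * (c * c))⁻¹ * a) - c * -((a * a + d * (c * c))⁻¹ * c) * d = 1 := by
      have h : a * ((a * a + d * (c * c))⁻¹ * a) - c * -((a * a + d * (c * c))⁻¹ * c) * d =
          (a * a + d * (c * c))⁻¹ * (a * a + d * (c * c)) := by ring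
      rw [h, inv_mul_cancel₀ hN]
    have h0 : a * -((a * a + d * (c * c))⁻¹ * c) + c * ((a * a + d * (c * c))⁻¹ * a) = 0 := by ring
    rw [h1, h0, one_smul, zero_smul, add_zero]

/-- **`End⁰(B)` is a field** for a complex abelian variety `B` with `φ ≫ φ = -d` (`d > 0`) and `dim_ℚ End⁰(B) = 2`:
`End⁰(B) = ℚ(φ) ≅ ℚ(√-d)`, an imaginary quadratic field (Ribet 1983 Thm. 3 / Moonen–Zarhin 1999 (2.3) type IV(1,1):
«`End⁰(X) = F` is an imaginary quadratic field»). [cite: Ribet1983, Thm. 3] [cite: MoonenZarhin1999LowDim, §2 (2.3)]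
[cite: MumfordAV1970, §19 Cor. 2 of Thm. 1 (p. 174)] -/
theorem isField_endAlgebra_of_ribetTypeOne {B : AbelianVariety ℂ} (φ : B ⟶ B) {d : ℕ} (hd : 0 < d)
    (hφ : φ ≫ φ = -(d • 𝟙 B)) (hE2 : Module.finrank ℚ B.endAlgebra = 2) : IsField B.endAlgebra := by
  have hx : AbelianVariety.endAlgebra.of B (End.of φ) * AbelianVariety.endAlgebra.of B (End.of φ) =
      -(((d : ℚ)) • (1 : B.endAlgebra)) := by
    rw [← map_mul, show End.of φ * End.of φ = End.of (φ ≫ φ) from rfl, hφ,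
      show End.of (-(d • 𝟙 B)) = -(d • (1 : End B)) from rfl, map_neg, map_nsmul, map_one, Nat.cast_smul_eq_nsmul]
  exact isField_of_finrank_eq_two_of_mul_self_eq_neg hE2 (by exact_mod_cast hd) hx

/-- **A complex abelian variety of Ribet shape (`φ ≫ φ = -d`, `d > 0`, `dim_ℚ End⁰ = 2`) is SIMPLE and NOT of CM type
once `dim B ≥ 2`** (`End⁰(B)` a field ⟹ simple, `AbelianVariety.isSimple_of_isField_endAlgebra`; `dim_ℚ End⁰(B) = 2 <
2 dim B` ⟹ not CM, L10 §1). [cite: MumfordAV1970, §19 Cor. 2 of Thm. 1 (p. 174)] [cite: Milne1999, §2 p. 54]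
[cite: MoonenZarhin1999LowDim, §2 (2.3)] -/
theorem isSimple_and_not_isOfCMType_of_ribetTypeOne {B : AbelianVariety ℂ} (φ : B ⟶ B) {d : ℕ} (hd : 0 < d)
    (hφ : φ ≫ φ = -(d • 𝟙 B)) (hE2 : Module.finrank ℚ B.endAlgebra = 2) (hdim : 2 ≤ B.dim) :
    B.IsSimple ∧ ¬ IsOfCMType B :=
  ⟨isSimple_of_isField_endAlgebra (isField_endAlgebra_of_ribetTypeOne φ hd hφ hE2),
    not_isOfCMType_of_finrank_endAlgebra_lt_two_mul_dim (by omega)⟩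

/-! ## §2 Ribet type `(dim B − 1, 1)`, any dimension `≥ 3`: both census conclusions on the isogeny class -/

/-- **Both census conclusions X2-at-`A`, X1-at-`A` at every `A` isogenous to a complex abelian variety `B` of Ribet
type `(dim B − 1, 1)`, `dim B ≥ 3`** (`End⁰(B) = ℚ(√-d)` acting on `H^{1,0}` with one of the two multiplicities equal
to `1`): `B = D` on `B` is the tree's UNCONDITIONAL `AbelianVariety.isDivisorGenerated_of_ribetTypeOne` (Ribet 1983
Thm. 3 with Thm. 0; Lie step `Lie Hg = 𝔲_k(V,ψ)` + FFT for `GL(W)`), and L10's `census_of_isIsogenous_of_isDivisorGenerated`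
transports the divisor summand along the isogeny. Any dimension; UNCONDITIONAL. [cite: Ribet1983, Thm. 0 and Thm. 3]
[cite: Gordon1997, Thm. 6.3 (3) (arXiv:alg-geom/9709030 p. 18)] [cite: MoonenZarhin1999LowDim, §2 (2.3) and §5 (5.1)]
[cite: vanGeemen1994HodgeAV, §2.4–2.5 and Lemma 3.7] -/
theorem census_of_isIsogenous_ribetTypeOne {A B : AbelianVariety ℂ} (φ : B ⟶ B) {d : ℕ} (hd : 0 < d)
    (hφ : φ ≫ φ = -(d • 𝟙 B)) (hE2 : Module.finrank ℚ B.endAlgebra = 2)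
    (h1 : eigenMultiplicity B φ (Complex.I * (Real.sqrt d : ℂ)) = 1 ∨
      eigenMultiplicity B φ (-(Complex.I * (Real.sqrt d : ℂ))) = 1)
    (hdim : 3 ≤ B.dim) (hAB : IsIsogenous A B) :
    (∀ c : complexBetti A.X (2 * 2), IsRationalClass c → IsOfHodgeType A.dim A.X (2 * 2) 2 2 c →
      c ∈ divisorClassesSpan A.X A.dim 2 ⊔ Submodule.span ℂ {w' : complexBetti A.X (2 * 2) |
        ∃ (C : AbelianVariety ℂ) (g : A.X ⟶ C.X) (w : complexBetti C.X (2 * 2)), C.dim < A.dim ∧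
          IsRationalClass w ∧ IsOfHodgeType C.dim C.X (2 * 2) 2 2 w ∧ w' = complexBetti.map g (2 * 2) w}) ∧
    (∀ c : complexBetti A.X (2 * 3), IsRationalClass c → IsOfHodgeType A.dim A.X (2 * 3) 3 3 c →
      c ∈ divisorClassesSpan A.X A.dim 3 ⊔ Submodule.span ℂ {w' : complexBetti A.X (2 * 3) |
          ∃ (a : complexBetti A.X (2 * 2)) (b : complexBetti A.X (2 * 1)),
            IsRationalClass a ∧ IsOfHodgeType A.dim A.X (2 * 2) 2 2 a ∧ IsRationalClass b ∧
            IsOfHodgeType A.dim A.X (2 * 1) 1 1 b ∧ w' = cupProduct (two_mul_add_two_mul 2 1) a b} ⊔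
        Submodule.span ℂ {w' : complexBetti A.X (2 * 3) |
          ∃ (C : AbelianVariety ℂ) (g : A.X ⟶ C.X) (w : complexBetti C.X (2 * 3)), C.dim < A.dim ∧
            IsRationalClass w ∧ IsOfHodgeType C.dim C.X (2 * 3) 3 3 w ∧ w' = complexBetti.map g (2 * 3) w} ⊔
        Submodule.span ℂ {w' : complexBetti A.X (2 * 3) |
          ∃ (B' : AbelianVariety ℂ) (g : A.X ⟶ B'.X) (d : ℕ) (ψ : B' ⟶ B') (w : complexBetti B'.X (2 * 3)),
            B'.dim = 6 ∧ 0 < d ∧ ψ ≫ ψ = -(d • 𝟙 B') ∧ IsRationalClass w ∧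
            IsOfHodgeType B'.dim B'.X (2 * 3) 3 3 w ∧ w ∈ weilClassesOf B' ψ 3 d ∧
            w' = complexBetti.map g (2 * 3) w}) :=
  census_of_isIsogenous_of_isDivisorGenerated hAB
    (AbelianVariety.isDivisorGenerated_of_ribetTypeOne B φ hd hφ hE2 h1 hdim)

/-- **L6's CONCLUSION on the isogeny class, from the floor alone: the Hodge conjecture holds for every complex abelian
variety isogenous to one of Ribet type `(dim − 1, 1)`, `dim ≥ 3`** — UNCONDITIONAL (`B = D` on the model, transported by
`hodgeConjectureFor_of_isIsogenous_of_isDivisorGenerated`; on `B` itself and on its powers this is the tree's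
`hodgeConjectureFor_powSucc_of_ribetTypeOne` by name). None of Markman₄ / Markman₆ / R-W6 / X2 / X1 / `HC_CM` enters.
[cite: Ribet1983, Thm. 0 and Thm. 3] [cite: Gordon1997, Thm. 6.2 and Thm. 6.3 (3)] [cite: vanGeemen1994HodgeAV, §2.4 and Lemma 3.7] -/
theorem hodgeConjectureFor_of_isIsogenous_ribetTypeOne {A B : AbelianVariety ℂ} (φ : B ⟶ B) {d : ℕ} (hd : 0 < d)
    (hφ : φ ≫ φ = -(d • 𝟙 B)) (hE2 : Module.finrank ℚ B.endAlgebra = 2)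
    (h1 : eigenMultiplicity B φ (Complex.I * (Real.sqrt d : ℂ)) = 1 ∨
      eigenMultiplicity B φ (-(Complex.I * (Real.sqrt d : ℂ))) = 1)
    (hdim : 3 ≤ B.dim) (hAB : IsIsogenous A B) : HodgeConjectureFor A.dim A.X :=
  hodgeConjectureFor_of_isIsogenous_of_isDivisorGenerated hAB
    (AbelianVariety.isDivisorGenerated_of_ribetTypeOne B φ hd hφ hE2 h1 hdim)

/-! ## §3 TABLE X row 8, the `(5,1)` half: kernel verdict with domain membership -/

/-- **Everything isogenous to a Ribet-shape SIXFOLD (`φ ≫ φ = -d`, `d > 0`, `dim_ℚ End⁰ = 2`) is in the nodes' domain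
`dim = 6 ∧ ¬ 𝒞`** (`B` simple and not CM by §1; L10 `offResidueSix_of_isIsogenous_of_isSimple_of_not_isOfCMType`). No
multiplicity hypothesis is needed for membership. [cite: MumfordAV1970, §19 Cor. 2 of Thm. 1 (p. 174)] [cite: Milne1999, §2 p. 54] -/
theorem offResidueSix_of_isIsogenous_ribetTypeOne {A B : AbelianVariety ℂ} (hB : B.dim = 6) (φ : B ⟶ B) {d : ℕ}
    (hd : 0 < d) (hφ : φ ≫ φ = -(d • 𝟙 B)) (hE2 : Module.finrank ℚ B.endAlgebra = 2) (hAB : IsIsogenous A B) :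
    A.dim = 6 ∧ ¬ (IsOfCMType A ∨ ProdCMCell IsQuarticFieldTypeIVFourfold (fun Z ↦ Z.dim = 2) A) :=
  have h := isSimple_and_not_isOfCMType_of_ribetTypeOne φ hd hφ hE2 (by omega)
  offResidueSix_of_isIsogenous_of_isSimple_of_not_isOfCMType hAB hB h.1 h.2

/-- **TABLE X ROW 8 `g6.IV(1,1)`, THE `(5,1)` HALF — KERNEL VERDICT on the whole isogeny class.** For a complex abelian
SIXFOLD `B` with `φ ∈ End(B)`, `φ ≫ φ = -d` (`d > 0`), `dim_ℚ End⁰(B) = 2` (so `End⁰(B) = ℚ(√-d)`, an imaginary quadratic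
field) and `φ^*` acting on `H^{1,0}(B)` with multiplicity `1` at `i√d` or at `-i√d` (signature `(5,1)`), and for every `A`
isogenous to `B`: `dim A = 6` and `A` is OFF the residue class `𝒞` — `A` is in the domain of the census nodes —, AND both
census conclusions X2-at-`A`, X1-at-`A` hold. UNCONDITIONAL; no named fact (Ribet 1983 Thm. 3 in the case `(dim − 1, 1)`
is the tree theorem `AbelianVariety.isDivisorGenerated_of_ribetTypeOne`). The `(4,2)` half of the row is NOT covered.
[cite: Ribet1983, Thm. 0 and Thm. 3] [cite: Gordon1997, Thm. 6.3 (3) (arXiv:alg-geom/9709030 p. 18)]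
[cite: MoonenZarhin1999LowDim, §2 (2.3) and §5 (5.1)] [cite: vanGeemen1994HodgeAV, Lemma 3.7] [cite: Milne1999, §2 p. 54] -/
theorem census_row8_fiveOne {A B : AbelianVariety ℂ} (hB : B.dim = 6) (φ : B ⟶ B) {d : ℕ} (hd : 0 < d)
    (hφ : φ ≫ φ = -(d • 𝟙 B)) (hE2 : Module.finrank ℚ B.endAlgebra = 2)
    (h1 : eigenMultiplicity B φ (Complex.I * (Real.sqrt d : ℂ)) = 1 ∨
      eigenMultiplicity B φ (-(Complex.I * (Real.sqrt d : ℂ))) = 1)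
    (hAB : IsIsogenous A B) :
    (A.dim = 6 ∧ ¬ (IsOfCMType A ∨ ProdCMCell IsQuarticFieldTypeIVFourfold (fun Z ↦ Z.dim = 2) A)) ∧
    (∀ c : complexBetti A.X (2 * 2), IsRationalClass c → IsOfHodgeType A.dim A.X (2 * 2) 2 2 c →
      c ∈ divisorClassesSpan A.X A.dim 2 ⊔ Submodule.span ℂ {w' : complexBetti A.X (2 * 2) |
        ∃ (C : AbelianVariety ℂ) (g : A.X ⟶ C.X) (w : complexBetti C.X (2 * 2)), C.dim < A.dim ∧
          IsRationalClass w ∧ IsOfHodgeType C.dim C.X (2 * 2) 2 2 w ∧ w' = complexBetti.map g (2 * 2) w}) ∧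
    (∀ c : complexBetti A.X (2 * 3), IsRationalClass c → IsOfHodgeType A.dim A.X (2 * 3) 3 3 c →
      c ∈ divisorClassesSpan A.X A.dim 3 ⊔ Submodule.span ℂ {w' : complexBetti A.X (2 * 3) |
          ∃ (a : complexBetti A.X (2 * 2)) (b : complexBetti A.X (2 * 1)),
            IsRationalClass a ∧ IsOfHodgeType A.dim A.X (2 * 2) 2 2 a ∧ IsRationalClass b ∧
            IsOfHodgeType A.dim A.X (2 * 1) 1 1 b ∧ w' = cupProduct (two_mul_add_two_mul 2 1) a b} ⊔
        Submodule.span ℂ {w' : complexBetti A.X (2 * 3) |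
          ∃ (C : AbelianVariety ℂ) (g : A.X ⟶ C.X) (w : complexBetti C.X (2 * 3)), C.dim < A.dim ∧
            IsRationalClass w ∧ IsOfHodgeType C.dim C.X (2 * 3) 3 3 w ∧ w' = complexBetti.map g (2 * 3) w} ⊔
        Submodule.span ℂ {w' : complexBetti A.X (2 * 3) |
          ∃ (B' : AbelianVariety ℂ) (g : A.X ⟶ B'.X) (d : ℕ) (ψ : B' ⟶ B') (w : complexBetti B'.X (2 * 3)),
            B'.dim = 6 ∧ 0 < d ∧ ψ ≫ ψ = -(d • 𝟙 B') ∧ IsRationalClass w ∧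
            IsOfHodgeType B'.dim B'.X (2 * 3) 3 3 w ∧ w ∈ weilClassesOf B' ψ 3 d ∧
            w' = complexBetti.map g (2 * 3) w}) :=
  ⟨offResidueSix_of_isIsogenous_ribetTypeOne hB φ hd hφ hE2 hAB,
    census_of_isIsogenous_ribetTypeOne φ hd hφ hE2 h1 (by omega) hAB⟩

/-- **Row 8 `(5,1)`, the model itself**: `B` is in the nodes' domain and satisfies X2-at-`B` ∧ X1-at-`B` (the case
`A = B` of `census_row8_fiveOne`, `IsIsogenous` being reflexive). UNCONDITIONAL. [cite: Ribet1983, Thm. 3]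
[cite: MoonenZarhin1999LowDim, §2 (2.3) and §5 (5.1)] -/
theorem census_row8_fiveOne_self {B : AbelianVariety ℂ} (hB : B.dim = 6) (φ : B ⟶ B) {d : ℕ} (hd : 0 < d)
    (hφ : φ ≫ φ = -(d • 𝟙 B)) (hE2 : Module.finrank ℚ B.endAlgebra = 2)
    (h1 : eigenMultiplicity B φ (Complex.I * (Real.sqrt d : ℂ)) = 1 ∨
      eigenMultiplicity B φ (-(Complex.I * (Real.sqrt d : ℂ))) = 1) :
    (B.dim = 6 ∧ ¬ (IsOfCMType B ∨ ProdCMCell IsQuarticFieldTypeIVFourfold (fun Z ↦ Z.dim = 2) B)) ∧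
    (∀ c : complexBetti B.X (2 * 2), IsRationalClass c → IsOfHodgeType B.dim B.X (2 * 2) 2 2 c →
      c ∈ divisorClassesSpan B.X B.dim 2 ⊔ Submodule.span ℂ {w' : complexBetti B.X (2 * 2) |
        ∃ (C : AbelianVariety ℂ) (g : B.X ⟶ C.X) (w : complexBetti C.X (2 * 2)), C.dim < B.dim ∧
          IsRationalClass w ∧ IsOfHodgeType C.dim C.X (2 * 2) 2 2 w ∧ w' = complexBetti.map g (2 * 2) w}) ∧
    (∀ c : complexBetti B.X (2 * 3), IsRationalClass c → IsOfHodgeType B.dim B.X (2 * 3) 3 3 c →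
      c ∈ divisorClassesSpan B.X B.dim 3 ⊔ Submodule.span ℂ {w' : complexBetti B.X (2 * 3) |
          ∃ (a : complexBetti B.X (2 * 2)) (b : complexBetti B.X (2 * 1)),
            IsRationalClass a ∧ IsOfHodgeType B.dim B.X (2 * 2) 2 2 a ∧ IsRationalClass b ∧
            IsOfHodgeType B.dim B.X (2 * 1) 1 1 b ∧ w' = cupProduct (two_mul_add_two_mul 2 1) a b} ⊔
        Submodule.span ℂ {w' : complexBetti B.X (2 * 3) |
          ∃ (C : AbelianVariety ℂ) (g : B.X ⟶ C.X) (w : complexBetti C.X (2 * 3)), C.dim < B.dim ∧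
            IsRationalClass w ∧ IsOfHodgeType C.dim C.X (2 * 3) 3 3 w ∧ w' = complexBetti.map g (2 * 3) w} ⊔
        Submodule.span ℂ {w' : complexBetti B.X (2 * 3) |
          ∃ (B' : AbelianVariety ℂ) (g : B.X ⟶ B'.X) (d : ℕ) (ψ : B' ⟶ B') (w : complexBetti B'.X (2 * 3)),
            B'.dim = 6 ∧ 0 < d ∧ ψ ≫ ψ = -(d • 𝟙 B') ∧ IsRationalClass w ∧
            IsOfHodgeType B'.dim B'.X (2 * 3) 3 3 w ∧ w ∈ weilClassesOf B' ψ 3 d ∧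
            w' = complexBetti.map g (2 * 3) w}) :=
  census_row8_fiveOne hB φ hd hφ hE2 h1 (IsIsogenous.refl B)

end Summit.HodgeConjecture.HodgeConjecture.TableX.TypeIVRows

end
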